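import Mathlib.Analysis.InnerProductSpace.Positive
import Mathlib.Analysis.MeanInequalities
import Mathlib.Analysis.SpecialFunctions.Pow.Real
import Mathlib.Algebra.BigOperators.NatAntidiagonal
import HarnessLib

/-!
# Pure-state Jensen for powers of a positive operator, and the tracial Hölder inequality in eigenbasis (sequence) form

Helper for crux `IRcof` (stmt-QuantumFields-26930), census row 47 «equipartition-seam» (line `Cruxes/IRcof/Lines/equipartition_seam.lean`,
ideator ym-ir-idea-22; S4ᵛ-F located stub «DefectFluxBound», ADAPTER (b) named by idea-22 g5 and checked by ym-ir-crit-3 g5, 2026-08-29):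
`|Tr_{ℋ_e}(𝕋ᵗ⁻¹𝔸_F)| ≤ Ẑ_t(e)^{(t−1)/t}·(Tr_{ℋ_e}𝔸_Fᵗ)^{1/t}`, hence `≤ K·Ẑ_t(e)` once `Tr_{ℋ_e}𝔸_Fᵗ ≤ Kᵗ·Tr_{ℋ_e}𝕋ᵗ`.
Pure analysis (Mathlib only, no definitions, no named facts); written by pool prover ym-ir-line-pool-p3 g16.

* `sum_antidiagonal_weight_secondDiff` — the bookkeeping identity behind `X^{n+2} − (n+2)sⁿ⁺¹X + (n+1)sⁿ⁺² =
  (X − s)² Σ_{j+k=n} (k+1) sᵏ Xʲ`, written for an arbitrary sequence `m : ℕ → R` in place of the powers `Xʲ`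
  (so that it applies verbatim to the moment sequence `m j = re ⟪Tʲ x, x⟫`).
* `isSymmetric_pow`, `isPositive_pow` — powers of a symmetric (resp. positive) linear map are symmetric (resp. positive);
  ELEMENTARY (no functional calculus, no square root): `⟪T²ⁱx, x⟫ = ‖Tⁱx‖²`, `⟪T²ⁱ⁺¹x, x⟫ = ⟪T(Tⁱx), Tⁱx⟫`.
* `pow_re_inner_le_re_inner_pow_apply` (**pure-state Jensen**) — for a positive linear map `T` on an inner-product space
  over `ℝ` or `ℂ` and a UNIT vector `x`: `(re ⟪T x, x⟫)ᵗ ≤ re ⟪Tᵗ x, x⟫` for every `t : ℕ` (convexity of `λ ↦ λᵗ` on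
  `[0,∞)` against the spectral measure of `x`; here proved without spectral theory from the identity above: with
  `s = ⟪Tx,x⟫` and `y = Tx − s x`, `0 ≤ Σ_{j+k=n}(k+1)sᵏ re⟪Tʲy, y⟫ = re⟪Tⁿ⁺²x,x⟫ − sⁿ⁺²`).
* `tsum_pow_mul_re_inner_le` (**tracial Hölder, sequence form**, the shape consumed through a Hilbert basis of eigenvectors
  of a transfer operator `𝕋`, cf. `Literature.Analysis.OperatorTheory.exists_hilbertBasis_eigenvectors_of_isSelfAdjoint`) — for unit vectors
  `bᵢ` (`i : ι`, ANY index type; orthonormality is not needed), reals `λᵢ ≥ 0`, a positive `T`, `t ≥ 1`, `HasSum (λᵢᵗ) Z` and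
  `HasSum (re⟪Tᵗ bᵢ, bᵢ⟫) W`:  `Σᵢ λᵢᵗ⁻¹·re⟪T bᵢ, bᵢ⟫` is summable and `≤ Z^{(t−1)/t} · W^{1/t}`.  With `bᵢ` an eigenbasis of
  `𝕋 ⪰ 0` restricted to an invariant subspace `ℋ` (`λᵢ` its eigenvalues) this reads
  `Tr_ℋ(𝕋ᵗ⁻¹ T) ≤ (Tr_ℋ 𝕋ᵗ)^{(t−1)/t} (Tr_ℋ Tᵗ)^{1/t}`, the tracial Hölder inequality with exponents `(t/(t−1), t)`
  [Simon, Trace Ideals, Thm 2.8; Bhatia, Matrix Analysis §IV.2]; the identification `W = Tr_ℋ Tᵗ` (basis independence of the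
  trace) and any sector bookkeeping stay with the consumer.  Also the `ContinuousLinearMap` wrapper `…_clm`.

HONEST: pure analysis bookkeeping; width toward PXcof ∕ N_cof ∕ `IRcof` 0; it proves nothing about Yang–Mills, confinement, `IRcof`,
`IR` or the Yang–Mills mass gap (Clay), which is NOT proved anywhere in this tree.
-/

set_option autoImplicit false

noncomputable section

namespace Summit.QuantumFields.YangMills.Cruxes.IRcof.EquipartitionSeam.TraceHolder

open scoped BigOperators InnerProductSpace
open Finset RCLike

/-! ## §1 The weighted second-difference identity (commutative bookkeeping) -/

section Identity

variable {R : Type*} [CommRing R]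

/-- **Weighted second-difference identity.**  For every sequence `m : ℕ → R` in a commutative ring, every `s : R` and `n : ℕ`:
`Σ_{j+k=n} (k+1)·sᵏ·(m_{j+2} − 2s·m_{j+1} + s²·m_j) = m_{n+2} − (n+2)·sⁿ⁺¹·m_1 + (n+1)·sⁿ⁺²·m_0`.
With `m_j = Xʲ` this is the polynomial identity `(X − s)²·Σ_{j+k=n}(k+1)sᵏXʲ = Xⁿ⁺² − (n+2)sⁿ⁺¹X + (n+1)sⁿ⁺²`
(the tangent-line remainder of `X ↦ Xⁿ⁺²` at `s`); stated for sequences so that it applies to moment sequences of an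
operator.  Proof: induction on `n`, peeling `(j,k) = (0,n+1)` off the antidiagonal and shifting `m`. [folklore] -/
theorem sum_antidiagonal_weight_secondDiff (m : ℕ → R) (s : R) (n : ℕ) :
    ∑ p ∈ antidiagonal n, ((p.2 + 1 : ℕ) : R) * s ^ p.2 * (m (p.1 + 2) - 2 * s * m (p.1 + 1) + s ^ 2 * m p.1) =
      m (n + 2) - ((n + 2 : ℕ) : R) * s ^ (n + 1) * m 1 + ((n + 1 : ℕ) : R) * s ^ (n + 2) * m 0 := by
  induction n generalizing m with
  | zero =>
    simp only [Nat.antidiagonal_zero, sum_singleton]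
    push_cast
    ring
  | succ n ih =>
    rw [Nat.sum_antidiagonal_succ]
    have h := ih (fun j => m (j + 1))
    rw [h]
    push_cast
    ring

end Identity

/-! ## §2 Powers of symmetric / positive linear maps; pure-state Jensen -/

section Jensen

variable {𝕜 : Type*} [RCLike 𝕜] {E : Type*} [NormedAddCommGroup E] [InnerProductSpace 𝕜 E]


/-- Powers of a symmetric linear map are symmetric (no completeness, no continuity needed). [folklore] -/
theorem isSymmetric_pow {T : E →ₗ[𝕜] E} (hT : T.IsSymmetric) (n : ℕ) : (T ^ n).IsSymmetric := by
  induction n with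
  | zero => intro x y; simp
  | succ n ih =>
    intro x y
    have h1 : (T ^ (n + 1)) x = (T ^ n) (T x) := by rw [pow_succ, Module.End.mul_apply]
    have h2 : (T ^ (n + 1)) y = T ((T ^ n) y) := by rw [pow_succ', Module.End.mul_apply]
    rw [h1, h2, ih, hT]

/-- `T` commutes with its powers at the level of vectors: `Tⁿ (T x) = T (Tⁿ x)`. [folklore] -/
theorem pow_apply_comm (T : E →ₗ[𝕜] E) (n : ℕ) (x : E) : (T ^ n) (T x) = T ((T ^ n) x) := by
  rw [← Module.End.mul_apply, ← pow_succ, pow_succ', Module.End.mul_apply]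

/-- **Powers of a positive linear map are positive**, elementary: `re⟪T²ⁱ x, x⟫ = re⟪Tⁱx, Tⁱx⟫ ≥ 0` and
`re⟪T²ⁱ⁺¹ x, x⟫ = re⟪T(Tⁱx), Tⁱx⟫ ≥ 0` (no square root, no functional calculus). [folklore] -/
theorem isPositive_pow {T : E →ₗ[𝕜] E} (hT : T.IsPositive) (n : ℕ) : (T ^ n).IsPositive := by
  refine ⟨isSymmetric_pow hT.isSymmetric n, fun x => ?_⟩
  obtain ⟨i, rfl | rfl⟩ := Nat.even_or_odd' n
  · have h : (T ^ (2 * i)) x = (T ^ i) ((T ^ i) x) := by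
      rw [two_mul, pow_add, Module.End.mul_apply]
    rw [h, isSymmetric_pow hT.isSymmetric i]
    exact inner_self_nonneg
  · have h : T ^ (2 * i + 1) = T ^ i * (T * T ^ i) := by
      rw [← pow_succ', ← pow_add]
      congr 1
      ring
    rw [h, Module.End.mul_apply, Module.End.mul_apply, isSymmetric_pow hT.isSymmetric i]
    exact hT.2 _

/-- The moments `re ⟪Tʲ x, x⟫` of a positive map are non-negative. [folklore] -/
theorem re_inner_pow_apply_nonneg {T : E →ₗ[𝕜] E} (hT : T.IsPositive) (j : ℕ) (x : E) :
    0 ≤ re ⟪(T ^ j) x, x⟫_𝕜 :=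
  (isPositive_pow hT j).2 x

/-- The second-difference of the moment sequence is a moment of `y = Tx − s x`: for symmetric `T`, real `s` and
`y := T x − s•x`,  `re⟪Tʲ y, y⟫ = re⟪Tʲ⁺² x, x⟫ − 2s·re⟪Tʲ⁺¹ x, x⟫ + s²·re⟪Tʲ x, x⟫`. [folklore] -/
theorem re_inner_pow_apply_sub_smul {T : E →ₗ[𝕜] E} (hT : T.IsSymmetric) (x : E) (s : ℝ) (j : ℕ) :
    re ⟪(T ^ j) (T x - (s : 𝕜) • x), T x - (s : 𝕜) • x⟫_𝕜 =
      re ⟪(T ^ (j + 2)) x, x⟫_𝕜 - 2 * s * re ⟪(T ^ (j + 1)) x, x⟫_𝕜 + s ^ 2 * re ⟪(T ^ j) x, x⟫_𝕜 := by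
  have hj := isSymmetric_pow hT j
  -- the four inner products
  have e1 : ⟪(T ^ j) (T x), T x⟫_𝕜 = ⟪(T ^ (j + 2)) x, x⟫_𝕜 := by
    rw [← Module.End.mul_apply, ← pow_succ, ← hT, ← Module.End.mul_apply, ← pow_succ']
  have e2 : ⟪(T ^ j) (T x), x⟫_𝕜 = ⟪(T ^ (j + 1)) x, x⟫_𝕜 := by
    rw [← Module.End.mul_apply, ← pow_succ]
  have e3 : ⟪(T ^ j) x, T x⟫_𝕜 = ⟪(T ^ (j + 1)) x, x⟫_𝕜 := by
    rw [← hT, ← Module.End.mul_apply, ← pow_succ']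
  simp only [map_sub, map_smul, inner_sub_left, inner_sub_right, inner_smul_left, inner_smul_right,
    RCLike.conj_ofReal, e1, e2, e3, map_sub, RCLike.re_ofReal_mul]
  ring

/-- **Pure-state Jensen inequality for powers.**  For a positive linear map `T` on an inner-product space over `ℝ` or `ℂ`
and a unit vector `x`, `(re ⟪T x, x⟫)ᵗ ≤ re ⟪Tᵗ x, x⟫` for every `t : ℕ` — the convexity of `λ ↦ λᵗ` on `[0, ∞)` against
the spectral measure of `x` («Jensen's inequality for the state `⟪x, · x⟫`»), here WITHOUT spectral theory: with
`s = re⟪Tx, x⟫`, `y = Tx − s x`, `0 ≤ Σ_{j+k=t−2} (k+1) sᵏ re⟪Tʲ y, y⟫ = re⟪Tᵗ x, x⟫ − sᵗ`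
(`sum_antidiagonal_weight_secondDiff` on the moment sequence). [folklore] -/
theorem pow_re_inner_le_re_inner_pow_apply {T : E →ₗ[𝕜] E} (hT : T.IsPositive) {x : E} (hx : ‖x‖ = 1) (t : ℕ) :
    (re ⟪T x, x⟫_𝕜) ^ t ≤ re ⟪(T ^ t) x, x⟫_𝕜 := by
  match t with
  | 0 =>
    have h : re ⟪(T ^ 0) x, x⟫_𝕜 = 1 := by
      rw [pow_zero, Module.End.one_apply, inner_self_eq_norm_sq_to_K]
      simp [hx]
    rw [h, pow_zero]
  | 1 => simp
  | n + 2 =>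
    set s : ℝ := re ⟪T x, x⟫_𝕜 with hs
    have hs0 : 0 ≤ s := hT.2 x
    set m : ℕ → ℝ := fun j => re ⟪(T ^ j) x, x⟫_𝕜 with hm
    have hm0 : m 0 = 1 := by
      simp only [hm, pow_zero, Module.End.one_apply, inner_self_eq_norm_sq_to_K, hx]
      simp
    have hm1 : m 1 = s := by simp [hm, hs]
    have key := sum_antidiagonal_weight_secondDiff m s n
    -- each summand is non-negative
    have hnn : 0 ≤ ∑ p ∈ antidiagonal n,
        ((p.2 + 1 : ℕ) : ℝ) * s ^ p.2 * (m (p.1 + 2) - 2 * s * m (p.1 + 1) + s ^ 2 * m p.1) := by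
      refine sum_nonneg fun p _ => mul_nonneg (mul_nonneg (by positivity) (pow_nonneg hs0 _)) ?_
      have h := re_inner_pow_apply_sub_smul hT.isSymmetric x s p.1
      simp only [hm]
      rw [← h]
      exact re_inner_pow_apply_nonneg hT p.1 _
    rw [key, hm0, hm1] at hnn
    have hcalc : m (n + 2) - ((n + 2 : ℕ) : ℝ) * s ^ (n + 1) * s + ((n + 1 : ℕ) : ℝ) * s ^ (n + 2) * 1 =
        m (n + 2) - s ^ (n + 2) := by
      push_cast
      ring
    rw [hcalc] at hnn
    simpa [hm] using sub_nonneg.mp hnn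

/-- Powers commute with the coercion `(E →L[𝕜] E) → (E →ₗ[𝕜] E)`, pointwise. [folklore] -/
theorem coe_clm_pow_apply (T : E →L[𝕜] E) (t : ℕ) (x : E) : ((T : E →ₗ[𝕜] E) ^ t) x = (T ^ t) x := by
  induction t generalizing x with
  | zero => simp
  | succ n ih =>
    rw [pow_succ, Module.End.mul_apply, pow_succ, ContinuousLinearMap.coe_coe, ih]
    rfl

/-- Pure-state Jensen, `ContinuousLinearMap` wrapper (the form transfer operators come in). [folklore] -/
theorem pow_re_inner_le_re_inner_pow_apply_clm {T : E →L[𝕜] E} (hT : T.IsPositive) {x : E} (hx : ‖x‖ = 1)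
    (t : ℕ) : (re ⟪T x, x⟫_𝕜) ^ t ≤ re ⟪(T ^ t) x, x⟫_𝕜 := by
  have h := pow_re_inner_le_re_inner_pow_apply hT.toLinearMap hx t
  rwa [coe_clm_pow_apply, ContinuousLinearMap.coe_coe] at h

end Jensen

/-! ## §3 Tracial Hölder, eigenbasis (sequence) form -/

section Holder

variable {𝕜 : Type*} [RCLike 𝕜] {E : Type*} [NormedAddCommGroup E] [InnerProductSpace 𝕜 E] {ι : Type*}


/-- **Tracial Hölder inequality, sequence form** (exponents `(t/(t−1), t)`).  Let `T` be a positive linear map, `bᵢ`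
(`i : ι`) UNIT vectors, `λᵢ ≥ 0` reals, `t ≥ 1`, with `Σᵢ λᵢᵗ = Z` and `Σᵢ re⟪Tᵗ bᵢ, bᵢ⟫ = W` (as `HasSum`s).  Then
`Σᵢ λᵢᵗ⁻¹ · re⟪T bᵢ, bᵢ⟫` is summable and `≤ Z^{(t−1)/t} · W^{1/t}`.  Proof: Hölder for series
(`Real.summable_and_inner_le_Lp_mul_Lq_tsum_of_nonneg`) with `fᵢ = λᵢᵗ⁻¹`, `gᵢ = re⟪T bᵢ, bᵢ⟫`, and pure-state Jensen
`gᵢᵗ ≤ re⟪Tᵗ bᵢ, bᵢ⟫` to dominate `Σ gᵢᵗ ≤ W`.  When `bᵢ` is an orthonormal eigenbasis of a positive `𝕋` (eigenvalues `λᵢ`)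
of an invariant subspace `ℋ`, the left side is `Tr_ℋ(𝕋ᵗ⁻¹T)` and `W = Tr_ℋ Tᵗ`: `Tr(𝕋ᵗ⁻¹T) ≤ (Tr 𝕋ᵗ)^{(t−1)/t}(Tr Tᵗ)^{1/t}`
(Hölder for trace ideals, Simon *Trace Ideals* Thm 2.8; Bhatia *Matrix Analysis* §IV.2). [folklore] -/
theorem tsum_pow_mul_re_inner_le {T : E →ₗ[𝕜] E} (hT : T.IsPositive) (b : ι → E) (hb : ∀ i, ‖b i‖ = 1)
    (lam : ι → ℝ) (hlam : ∀ i, 0 ≤ lam i) {t : ℕ} (ht : 1 ≤ t) {Z W : ℝ}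
    (hZ : HasSum (fun i => lam i ^ t) Z) (hW : HasSum (fun i => re ⟪(T ^ t) (b i), b i⟫_𝕜) W) :
    Summable (fun i => lam i ^ (t - 1) * re ⟪T (b i), b i⟫_𝕜) ∧
      ∑' i, lam i ^ (t - 1) * re ⟪T (b i), b i⟫_𝕜 ≤ Z ^ (((t : ℝ) - 1) / t) * W ^ ((1 : ℝ) / t) := by
  have hg0 : ∀ i, 0 ≤ re ⟪T (b i), b i⟫_𝕜 := fun i => hT.2 (b i)
  have hW0 : 0 ≤ W := hW.nonneg (fun i => re_inner_pow_apply_nonneg hT t (b i))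
  have hZ0 : 0 ≤ Z := hZ.nonneg (fun i => pow_nonneg (hlam i) t)
  rcases Nat.lt_or_ge t 2 with h2 | h2
  · -- t = 1
    have ht1 : t = 1 := by omega
    subst ht1
    have hW' : HasSum (fun i => lam i ^ (1 - 1) * re ⟪T (b i), b i⟫_𝕜) W := by
      simpa using hW
    refine ⟨hW'.summable, ?_⟩
    rw [hW'.tsum_eq]
    simp [Real.rpow_one]
  · -- t ≥ 2 : Hölder with p = t/(t-1), q = t
    have htR : (2 : ℝ) ≤ t := by exact_mod_cast h2
    have ht1R : ((t - 1 : ℕ) : ℝ) = (t : ℝ) - 1 := by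
      rw [Nat.cast_sub ht]; simp
    set p : ℝ := (t : ℝ) / ((t : ℝ) - 1) with hp
    set q : ℝ := (t : ℝ) with hq
    have hpos : 0 < (t : ℝ) - 1 := by linarith
    have htne : (t : ℝ) ≠ 0 := by linarith
    have hpq : p.HolderConjugate q := by
      rw [Real.holderConjugate_iff]
      refine ⟨?_, ?_⟩
      · rw [hp, one_lt_div hpos]; linarith
      · rw [hp, hq, inv_div, inv_eq_one_div, ← add_div, sub_add_cancel, div_self htne]
    set f : ι → ℝ := fun i => lam i ^ (t - 1) with hf
    set g : ι → ℝ := fun i => re ⟪T (b i), b i⟫_𝕜 with hgdef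
    have hf0 : ∀ i, 0 ≤ f i := fun i => pow_nonneg (hlam i) _
    -- f ^ p = lam ^ t
    have hfp : ∀ i, f i ^ p = lam i ^ t := by
      intro i
      simp only [hf]
      rw [← Real.rpow_natCast (lam i) (t - 1), ← Real.rpow_mul (hlam i), ht1R, hp,
        mul_div_cancel₀ _ hpos.ne', Real.rpow_natCast]
    have hf_sum : Summable fun i => f i ^ p := by
      simp_rw [hfp]; exact hZ.summable
    -- g ^ q ≤ re ⟪T^t b, b⟫_𝕜 (pure-state Jensen), hence summable
    have hgq : ∀ i, g i ^ q = re ⟪T (b i), b i⟫_𝕜 ^ t := fun i => by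
      simp only [hgdef, hq]; rw [Real.rpow_natCast]
    have hgle : ∀ i, g i ^ q ≤ re ⟪(T ^ t) (b i), b i⟫_𝕜 := fun i => by
      rw [hgq]; exact pow_re_inner_le_re_inner_pow_apply hT (hb i) t
    have hg_sum : Summable fun i => g i ^ q :=
      Summable.of_nonneg_of_le (fun i => by rw [hgq]; exact pow_nonneg (hg0 i) t) hgle hW.summable
    obtain ⟨hsum, hle⟩ := Real.summable_and_inner_le_Lp_mul_Lq_tsum_of_nonneg hpq hf0 hg0 hf_sum hg_sum
    refine ⟨hsum, hle.trans ?_⟩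
    -- identify / dominate the two factors
    have hZeq : ∑' i, f i ^ p = Z := by simp_rw [hfp]; exact hZ.tsum_eq
    have h1p : 1 / p = ((t : ℝ) - 1) / t := by rw [hp, one_div_div]
    have h1q : 1 / q = (1 : ℝ) / t := by rw [hq]
    have hgW : ∑' i, g i ^ q ≤ W := by
      rw [← hW.tsum_eq]
      exact Summable.tsum_le_tsum hgle hg_sum hW.summable
    have hg0' : 0 ≤ ∑' i, g i ^ q := tsum_nonneg fun i => by rw [hgq]; exact pow_nonneg (hg0 i) t
    rw [hZeq, h1p, h1q]
    exact mul_le_mul_of_nonneg_left (Real.rpow_le_rpow hg0' hgW (by positivity)) (Real.rpow_nonneg hZ0 _)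

/-- **Flux-domination shape** (the consumed corollary): if moreover `W ≤ Kᵗ·Z` with `K ≥ 0` («the inserted model's
trace of `Tᵗ` is at most `Kᵗ` times `Tr 𝕋ᵗ`»), then `Σᵢ λᵢᵗ⁻¹·re⟪T bᵢ, bᵢ⟫ ≤ K·Z` — i.e.
`Tr(𝕋ᵗ⁻¹T) ≤ K·Tr 𝕋ᵗ` with the SAME extent `t` on both sides and no loss in the exponent. [folklore] -/
theorem tsum_pow_mul_re_inner_le_of_le_pow_mul {T : E →ₗ[𝕜] E} (hT : T.IsPositive) (b : ι → E)
    (hb : ∀ i, ‖b i‖ = 1) (lam : ι → ℝ) (hlam : ∀ i, 0 ≤ lam i) {t : ℕ} (ht : 1 ≤ t) {Z W K : ℝ}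
    (hZ : HasSum (fun i => lam i ^ t) Z) (hW : HasSum (fun i => re ⟪(T ^ t) (b i), b i⟫_𝕜) W)
    (hK : 0 ≤ K) (hWK : W ≤ K ^ t * Z) :
    ∑' i, lam i ^ (t - 1) * re ⟪T (b i), b i⟫_𝕜 ≤ K * Z := by
  obtain ⟨-, hle⟩ := tsum_pow_mul_re_inner_le hT b hb lam hlam ht hZ hW
  have hZ0 : 0 ≤ Z := hZ.nonneg (fun i => pow_nonneg (hlam i) t)
  have hW0 : 0 ≤ W := hW.nonneg (fun i => re_inner_pow_apply_nonneg hT t (b i))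
  have htpos : (0 : ℝ) < t := by exact_mod_cast ht
  have htne : (t : ℝ) ≠ 0 := htpos.ne'
  refine hle.trans ?_
  have h1 : W ^ ((1 : ℝ) / t) ≤ (K ^ t * Z) ^ ((1 : ℝ) / t) :=
    Real.rpow_le_rpow hW0 hWK (by positivity)
  have h2 : (K ^ t * Z) ^ ((1 : ℝ) / t) = K * Z ^ ((1 : ℝ) / t) := by
    rw [Real.mul_rpow (pow_nonneg hK t) hZ0, one_div, Real.pow_rpow_inv_natCast hK (by omega)]
  have h3 : Z ^ (((t : ℝ) - 1) / t) * (K * Z ^ ((1 : ℝ) / t)) = K * Z := by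
    have hsum : ((t : ℝ) - 1) / t + 1 / t = 1 := by
      rw [← add_div, sub_add_cancel, div_self htne]
    calc Z ^ (((t : ℝ) - 1) / t) * (K * Z ^ ((1 : ℝ) / t))
        = K * (Z ^ (((t : ℝ) - 1) / t) * Z ^ ((1 : ℝ) / t)) := by ring
      _ = K * Z ^ (((t : ℝ) - 1) / t + 1 / t) := by
          rw [← Real.rpow_add' hZ0 (by rw [hsum]; exact one_ne_zero)]
      _ = K * Z := by rw [hsum, Real.rpow_one]
  calc Z ^ (((t : ℝ) - 1) / t) * W ^ ((1 : ℝ) / t)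
      ≤ Z ^ (((t : ℝ) - 1) / t) * (K ^ t * Z) ^ ((1 : ℝ) / t) :=
        mul_le_mul_of_nonneg_left h1 (Real.rpow_nonneg hZ0 _)
    _ = K * Z := by rw [h2, h3]

/-- Tracial Hölder, `ContinuousLinearMap` wrapper: same statement for a positive `T : E →L[𝕜] E`. [folklore] -/
theorem tsum_pow_mul_re_inner_le_clm {T : E →L[𝕜] E} (hT : T.IsPositive) (b : ι → E) (hb : ∀ i, ‖b i‖ = 1)
    (lam : ι → ℝ) (hlam : ∀ i, 0 ≤ lam i) {t : ℕ} (ht : 1 ≤ t) {Z W : ℝ}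
    (hZ : HasSum (fun i => lam i ^ t) Z) (hW : HasSum (fun i => re ⟪(T ^ t) (b i), b i⟫_𝕜) W) :
    Summable (fun i => lam i ^ (t - 1) * re ⟪T (b i), b i⟫_𝕜) ∧
      ∑' i, lam i ^ (t - 1) * re ⟪T (b i), b i⟫_𝕜 ≤ Z ^ (((t : ℝ) - 1) / t) * W ^ ((1 : ℝ) / t) := by
  have hW' : HasSum (fun i => re ⟪((T : E →ₗ[𝕜] E) ^ t) (b i), b i⟫_𝕜) W := by
    simpa only [coe_clm_pow_apply] using hW
  simpa only [ContinuousLinearMap.coe_coe] using tsum_pow_mul_re_inner_le hT.toLinearMap b hb lam hlam ht hZ hW'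

end Holder

end Summit.QuantumFields.YangMills.Cruxes.IRcof.EquipartitionSeam.TraceHolder

end
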